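import Summits.CriticalPhenomena.Ising3DConformalLimit.Theorems.AnomalousForcesInteractionEtaPositiveBoxResponse
import Summits.CriticalPhenomena.Ising3DConformalLimit.Theorems.AnomalousForcesInteractionEtaPositiveReduction
import HarnessLib

/-!
# Crux `EtaPositive` (stmt-CriticalPhenomena-2600) closed modulo the upper critical isotherm

Route `AnomalousForcesInteraction` (Ising3DConformalLimit), line `birth`. The two landed pieces of the line —
the finite-box fluctuation–response inequality at `β_c(3)` in a field (`stub_boxResponse`,
`Theorems/AnomalousForcesInteractionEtaPositiveBoxResponse.lean`) and the effective Buckingham–Gunton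
reduction (`criticalTwoPoint_decay_of_boxResponse_of_isotherm`, `etaPositive_of_boxResponse_isothermGain`,
`Theorems/AnomalousForcesInteractionEtaPositiveReduction.lean`) — are composed here into the two
hypothesis-minimal statements that remain once `stub_boxResponse` is discharged:

* `criticalTwoPoint_decay_of_isotherm` — **the effective Buckingham–Gunton inequality at `β_c(3)`,
  unconditionally in the box inequality**: ANY upper critical-isotherm bound `m(β_c(3),h) ≤ A h^b` on `(0,h₀]`
  with `b > 0` forces `⟨σ₀σ_x⟩⁺_{β_c(3)} ≤ C‖x‖^{-6b/(b+1)}` for all `x ≠ 0` (`1 + η ≥ 6/(δ+1)` in exponent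
  language; `b = 1/5` returns exactly the infrared exponent `1`, `b = 1/3` — the mean-field cap of
  Aizenman–Barsky–Fernández — would give `3/2`).
* `EtaPositive_of_isothermGain` — **the crux BY NAME from the one open stub**: the registered stub
  `stub_isothermGain` (`∃ b > 1/5, A, h₀ > 0, ∀ h ∈ (0,h₀], m(β_c(3),h) ≤ A h^b`, "`1/δ > 1/5` in upper-bound
  form") implies `Summit.CriticalPhenomena.Ising3DConformalLimit.Theses.AnomalousForcesInteraction.EtaPositive`.
  This is the "closed modulo X" certificate of the line: the day an isotherm bound with some `b > 1/5` is a
  theorem `T`, the crux closes by `EtaPositive_of_isothermGain T`.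

No named fact is assumed; the only hypothesis is the isotherm bound itself (an open problem on `ℤ³`: no
power-law upper bound on the critical isotherm is known in `d = 3`, cf. `Cruxes/EtaPositive/PROMOTE.md`).
-/

noncomputable section

namespace Summit.CriticalPhenomena.Ising3DConformalLimit.AnomalousForcesInteractionEtaPositive

open Literature.Probability.LatticeModels

/-- **Effective Buckingham–Gunton inequality at `β_c(3)`** (Buckingham–Gunton 1969 / Fisher 1969,
`2 - η ≤ d(δ-1)/(δ+1)` at `d = 3`, made effective and unconditional in the lattice input): if the critical
isotherm of the nearest-neighbour Ising model on `ℤ³` satisfies `m(β_c, h) ≤ A h^b` for `h ∈ (0, h₀]` with some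
`b > 0`, then `⟨σ₀σ_x⟩⁺_{β_c,0} ≤ C ‖x‖^{-6b/(b+1)}` for every `x ≠ 0` (sup norm). Composition of the landed
`stub_boxResponse` (GHS + GKS + Messager–Miracle-Solé) with `criticalTwoPoint_decay_of_boxResponse_of_isotherm`. -/
theorem criticalTwoPoint_decay_of_isotherm :
    ∀ b A h₀ : ℝ, 0 < b → 0 < h₀ →
      (∀ h : ℝ, 0 < h → h ≤ h₀ → magnetizationInField 3 (criticalBeta 3) h ≤ A * h ^ b) →
      ∃ C : ℝ, ∀ x : Site 3, x ≠ 0 →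
        criticalTwoPoint 3 x ≤ C * (‖x‖ : ℝ) ^ (-(6 * b / (b + 1))) :=
  fun _ _ _ hb0 hh₀ hM => criticalTwoPoint_decay_of_boxResponse_of_isotherm stub_boxResponse hb0 hh₀ hM

/-- **The crux `EtaPositive` from the upper critical isotherm alone** (line `birth` closed modulo its one
open stub): if `m(β_c(3), h) ≤ A h^b` on `(0, h₀]` for SOME exponent `b > 1/5` ("`1/δ > 1/5` in upper-bound
form"), then `EtaPositive` holds, with `κ = (5b-1)/(b+1)`. The statement of the hypothesis is verbatim the
registered stub `stub_isothermGain` of stmt-CriticalPhenomena-2600; the conclusion is the route decl by name. -/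
theorem EtaPositive_of_isothermGain :
    (∃ b A h₀ : ℝ, 1 / 5 < b ∧ 0 < h₀ ∧ ∀ h : ℝ, 0 < h → h ≤ h₀ →
      magnetizationInField 3 (criticalBeta 3) h ≤ A * h ^ b) →
    Summit.CriticalPhenomena.Ising3DConformalLimit.Theses.AnomalousForcesInteraction.EtaPositive :=
  fun hIso => etaPositive_of_boxResponse_isothermGain stub_boxResponse hIso

end Summit.CriticalPhenomena.Ising3DConformalLimit.AnomalousForcesInteractionEtaPositive
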